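import Mathlib
import Summits.Ventures.PercRepro2.SwOutCrossGenSumJoint

/-!
# Two cross components as one fibre: the inequality of the glued fibre (blind cell PercRepro2,
night-4 g25, 2026-08-28; proofs/NIGHT4-G25.md §2)

The cube of the glued fibre `fibKEESum` over the u-arms `ι` is the cube of the joint product
`F₁.prodL (fibKEEBit G₂ hG₂) (jointKE …)` read through the gluing: the points correspond by
`glueKE` / `splitKE`, the atoms by `aMap` (the edge atoms of the two components as edge atoms of
the sum, `aKE`), the leak, the type (the SAME joint label on both sides) and the red and blue
atoms correspond (`leakI_sum_iff`, `ERI_sum_eq`, `EBI_sum_eq`).  Hence **`ineq_fibKEESum`**: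
the inequality of `ineq_prodL` holds for the glued fibre — the abstract theorem of boundary (iv)
for TWO connected cross components at one junction with the JOINT order, on the fibre
`FibKE (X₁ ⊕ X₂) (G₁ ⊕g G₂)` the geometry uses; and since `fibKEESum` has the `KE` fields, it
iterates (`ineq_fibKEESum₂`: the instance from two connected components; a third component is
`fibKEESum` applied to it).
-/

namespace Summit.Ventures.PercRepro2

namespace CrossArm

open Classical

section Atoms

variable {X₁ X₂ : Type*} (G₁ : SimpleGraph X₁) (G₂ : SimpleGraph X₂)

/-- The edge atoms of the two components as edge atoms of the sum. -/
def aKE : AtomKEE X₁ G₁ ⊕ AtomKEE X₂ G₂ → AtomKEE (X₁ ⊕ X₂) (G₁ ⊕g G₂)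
  | Sum.inl (Sum.inl i) => Sum.inl (Sum.inl i)
  | Sum.inl (Sum.inr s) =>
      Sum.inr ((SimpleGraph.edgeSetSumEquiv (G := G₁) (H := G₂)).symm (Sum.inl s))
  | Sum.inr (Sum.inl i) => Sum.inl (Sum.inr i)
  | Sum.inr (Sum.inr s) =>
      Sum.inr ((SimpleGraph.edgeSetSumEquiv (G := G₁) (H := G₂)).symm (Sum.inr s))

/-- `aKE` is injective. -/
lemma aKE_injective : Function.Injective (aKE G₁ G₂) := by
  rintro ((i | s) | (i | s)) ((j | t) | (j | t)) h <;>
    simp only [aKE, Sum.inl.injEq, Sum.inr.injEq, reduceCtorEq, EmbeddingLike.apply_eq_iff_eq] at h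
  · rw [h]
  · rw [h]
  · rw [h]
  · rw [h]

/-- `aKE` is surjective. -/
lemma aKE_surjective : Function.Surjective (aKE G₁ G₂) := by
  rintro ((i | j) | s)
  · exact ⟨Sum.inl (Sum.inl i), rfl⟩
  · exact ⟨Sum.inr (Sum.inl j), rfl⟩
  · obtain ⟨s', rfl⟩ := (SimpleGraph.edgeSetSumEquiv (G := G₁) (H := G₂)).symm.surjective s
    rcases s' with s₁ | s₂
    · exact ⟨Sum.inl (Sum.inr s₁), rfl⟩
    · exact ⟨Sum.inr (Sum.inr s₂), rfl⟩

variable (ι : Type*)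

/-- The atoms of the product cube as atoms of the glued cube. -/
def aMap : AtomG (AtomKEE X₁ G₁ ⊕ AtomKEE X₂ G₂) ι → AtomG (AtomKEE (X₁ ⊕ X₂) (G₁ ⊕g G₂)) ι :=
  Sum.map id (Sum.map id (aKE G₁ G₂))

/-- `aMap` is injective. -/
lemma aMap_injective : Function.Injective (aMap G₁ G₂ ι) :=
  Function.injective_id.sumMap (Function.injective_id.sumMap (aKE_injective G₁ G₂))

/-- `aMap` is surjective. -/
lemma aMap_surjective : Function.Surjective (aMap G₁ G₂ ι) :=
  Function.surjective_id.sumMap (Function.surjective_id.sumMap (aKE_surjective G₁ G₂))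

end Atoms

section Transport

variable {X₁ X₂ : Type*} {G₁ : SimpleGraph X₁} (G₂ : SimpleGraph X₂) [Fintype X₂] [DecidableEq X₂]
  [DecidableRel G₂.Adj] [Nonempty X₂] (hG₂ : G₂.Connected)
  (F₁ : FibreIter (FibKE X₁ G₁) (AtomKEE X₁ G₁) (LabelKE X₁))
  (hflip : F₁.flip = FibKE.flip) (hleak : F₁.leakR = leakKE G₁)
  (hlab : F₁.label = labelKE G₁) (hB : F₁.BetterL = BetterKE) (hred : F₁.red = redKEE G₁)
  {ι : Type*}

include hflip hleak hlab hB hred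

/-- The leak of the glued cube is the leak of the product cube. -/
lemma leakI_sum_iff (s : Config ι) (w₁ : FibKE X₁ G₁) (w₂ : FibKE X₂ G₂) :
    LeakI (fibKEESum G₂ F₁ hflip hleak hlab hB hred) (s, glueKE G₁ G₂ w₁ w₂) ↔
      LeakI (F₁.prodL (fibKEEBit G₂ hG₂) (jointKE G₂ hG₂ F₁ hflip hleak hlab hB)) (s, (w₁, w₂)) := by
  show (redUG s ∧ leakKE (G₁ ⊕g G₂) (glueKE G₁ G₂ w₁ w₂) = true) ∨
      (blueUG s ∧ leakKE (G₁ ⊕g G₂) (glueKE G₁ G₂ w₁ w₂).flip = true) ↔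
    (redUG s ∧ (F₁.leakR w₁ || leakKE G₂ w₂) = true) ∨
      (blueUG s ∧ (F₁.leakR (F₁.flip w₁) || leakKE G₂ w₂.flip) = true)
  rw [← glueKE_flip, leakKE_glue, leakKE_glue, hleak, hflip]

/-- The red atoms of the glued cube, atom by atom through `aMap`. -/
lemma mem_ERI_sum_iff (s : Config ι) (w₁ : FibKE X₁ G₁) (w₂ : FibKE X₂ G₂)
    (b : AtomG (AtomKEE X₁ G₁ ⊕ AtomKEE X₂ G₂) ι) :
    aMap G₁ G₂ ι b ∈ ERI (fibKEESum G₂ F₁ hflip hleak hlab hB hred) (s, glueKE G₁ G₂ w₁ w₂) ↔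
      b ∈ ERI (F₁.prodL (fibKEEBit G₂ hG₂) (jointKE G₂ hG₂ F₁ hflip hleak hlab hB)) (s, (w₁, w₂)) := by
  rcases b with j | (u | ((i | t) | (i | t)))
  · exact Iff.rfl
  · exact Iff.rfl
  · show redUG s ∧ redKEE (G₁ ⊕g G₂) (glueKE G₁ G₂ w₁ w₂) (Sum.inl (Sum.inl i)) = true ↔
      redUG s ∧ F₁.red w₁ (Sum.inl i) = true
    rw [redKEE_glue_inl, hred]
  · show redUG s ∧ redKEE (G₁ ⊕g G₂) (glueKE G₁ G₂ w₁ w₂)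
        (Sum.inr ((SimpleGraph.edgeSetSumEquiv (G := G₁) (H := G₂)).symm (Sum.inl t))) = true ↔
      redUG s ∧ F₁.red w₁ (Sum.inr t) = true
    rw [redKEE_glue_edge_inl, hred]
  · show redUG s ∧ redKEE (G₁ ⊕g G₂) (glueKE G₁ G₂ w₁ w₂) (Sum.inl (Sum.inr i)) = true ↔
      redUG s ∧ redKEE G₂ w₂ (Sum.inl i) = true
    rw [redKEE_glue_inr]
  · show redUG s ∧ redKEE (G₁ ⊕g G₂) (glueKE G₁ G₂ w₁ w₂)
        (Sum.inr ((SimpleGraph.edgeSetSumEquiv (G := G₁) (H := G₂)).symm (Sum.inr t))) = true ↔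
      redUG s ∧ redKEE G₂ w₂ (Sum.inr t) = true
    rw [redKEE_glue_edge_inr]

/-- The red atoms of the glued cube are the image of those of the product cube. -/
lemma ERI_sum_eq (s : Config ι) (w₁ : FibKE X₁ G₁) (w₂ : FibKE X₂ G₂) :
    ERI (fibKEESum G₂ F₁ hflip hleak hlab hB hred) (s, glueKE G₁ G₂ w₁ w₂) =
      aMap G₁ G₂ ι ''
        ERI (F₁.prodL (fibKEEBit G₂ hG₂) (jointKE G₂ hG₂ F₁ hflip hleak hlab hB)) (s, (w₁, w₂)) := by
  ext a
  constructor
  · intro ha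
    obtain ⟨b, rfl⟩ := aMap_surjective G₁ G₂ ι a
    exact ⟨b, (mem_ERI_sum_iff G₂ hG₂ F₁ hflip hleak hlab hB hred s w₁ w₂ b).1 ha, rfl⟩
  · rintro ⟨b, hb, rfl⟩
    exact (mem_ERI_sum_iff G₂ hG₂ F₁ hflip hleak hlab hB hred s w₁ w₂ b).2 hb

/-- The blue atoms of the glued cube are the image of those of the product cube. -/
lemma EBI_sum_eq (s : Config ι) (w₁ : FibKE X₁ G₁) (w₂ : FibKE X₂ G₂) :
    EBI (fibKEESum G₂ F₁ hflip hleak hlab hB hred) (s, glueKE G₁ G₂ w₁ w₂) =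
      aMap G₁ G₂ ι ''
        EBI (F₁.prodL (fibKEEBit G₂ hG₂) (jointKE G₂ hG₂ F₁ hflip hleak hlab hB)) (s, (w₁, w₂)) := by
  show ERI (fibKEESum G₂ F₁ hflip hleak hlab hB hred) (flipAll s, (glueKE G₁ G₂ w₁ w₂).flip) =
    aMap G₁ G₂ ι '' ERI (F₁.prodL (fibKEEBit G₂ hG₂) (jointKE G₂ hG₂ F₁ hflip hleak hlab hB))
      (flipAll s, (F₁.flip w₁, w₂.flip))
  rw [hflip, ← glueKE_flip]
  exact ERI_sum_eq G₂ hG₂ F₁ hflip hleak hlab hB hred (flipAll s) w₁.flip w₂.flip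

variable [Fintype ι] [DecidableEq ι] [Fintype X₁] [DecidableEq X₁] [DecidableRel G₁.Adj] [Nonempty ι]

omit [Nonempty ι] in
/-- A point of the glued cube is in `QI` iff its split is in `QI` of the product cube. -/
lemma mem_QI_sum_iff (𝒯 : Set (TypG (LabelKE (X₁ ⊕ X₂)) ι)) (s : Config ι) (w₁ : FibKE X₁ G₁)
    (w₂ : FibKE X₂ G₂) :
    (s, glueKE G₁ G₂ w₁ w₂) ∈ QI (fibKEESum G₂ F₁ hflip hleak hlab hB hred) 𝒯 ↔
      (s, (w₁, w₂)) ∈ QI (F₁.prodL (fibKEEBit G₂ hG₂) (jointKE G₂ hG₂ F₁ hflip hleak hlab hB)) 𝒯 := by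
  rw [mem_QI, mem_QI, leakI_sum_iff G₂ hG₂]
  exact Iff.rfl

include hG₂ in
/-- **THE INEQUALITY OF THE GLUED FIBRE**: the abstract theorem of boundary (iv) for a first
fibre with the `KE` fields and a further connected cross component, with the JOINT order, on the
fibre of the disjoint-union graph. -/
theorem ineq_fibKEESum (hineq : Ineq F₁ (ι := ι)) :
    Ineq (fibKEESum G₂ F₁ hflip hleak hlab hB hred) (ι := ι) := by
  intro 𝒯 𝓔 h𝒯 h𝓔
  set S := fibKEESum G₂ F₁ hflip hleak hlab hB hred with hS
  set P := F₁.prodL (fibKEEBit G₂ hG₂) (jointKE G₂ hG₂ F₁ hflip hleak hlab hB) with hP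
  let 𝓔' : Set (Set (AtomG (AtomKEE X₁ G₁ ⊕ AtomKEE X₂ G₂) ι)) := {T | aMap G₁ G₂ ι '' T ∈ 𝓔}
  have h𝓔' : IsUpperSet 𝓔' := fun T T' hTT' hT => h𝓔 (Set.image_mono hTT') hT
  have h𝒯' : IsUpI P 𝒯 := fun t ht t' hle => h𝒯 t ht t' hle
  have key := ineq_prodL (jointKE G₂ hG₂ F₁ hflip hleak hlab hB) hineq 𝒯 𝓔' h𝒯' h𝓔'
  have e1 : ((QI S 𝒯).filter fun q => ERI S q ∈ 𝓔).card =
      ((QI P 𝒯).filter fun x => ERI P x ∈ 𝓔').card := by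
    refine Finset.card_bij' (fun q _ => (q.1, splitKE G₁ G₂ q.2))
      (fun x _ => (x.1, glueKE G₁ G₂ x.2.1 x.2.2)) ?_ ?_ ?_ ?_
    · intro q hq
      rw [Finset.mem_filter] at hq ⊢
      obtain ⟨hQ, hE⟩ := hq
      have hq' : q = (q.1, glueKE G₁ G₂ (splitKE G₁ G₂ q.2).1 (splitKE G₁ G₂ q.2).2) := by
        rw [glueKE_splitKE]
      rw [hq', mem_QI_sum_iff G₂ hG₂] at hQ
      rw [hq', ERI_sum_eq G₂ hG₂] at hE
      exact ⟨hQ, hE⟩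
    · intro x hx
      rw [Finset.mem_filter] at hx ⊢
      obtain ⟨hQ, hE⟩ := hx
      rw [mem_QI_sum_iff G₂ hG₂]
      refine ⟨hQ, ?_⟩
      rw [ERI_sum_eq G₂ hG₂]
      exact hE
    · intro q _
      show (q.1, glueKE G₁ G₂ (splitKE G₁ G₂ q.2).1 (splitKE G₁ G₂ q.2).2) = q
      rw [glueKE_splitKE]
    · intro x _
      show (x.1, splitKE G₁ G₂ (glueKE G₁ G₂ x.2.1 x.2.2)) = x
      rw [splitKE_glueKE]
  have e2 : ((QI S 𝒯).filter fun q => EBI S q ∈ 𝓔).card =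
      ((QI P 𝒯).filter fun x => EBI P x ∈ 𝓔').card := by
    refine Finset.card_bij' (fun q _ => (q.1, splitKE G₁ G₂ q.2))
      (fun x _ => (x.1, glueKE G₁ G₂ x.2.1 x.2.2)) ?_ ?_ ?_ ?_
    · intro q hq
      rw [Finset.mem_filter] at hq ⊢
      obtain ⟨hQ, hE⟩ := hq
      have hq' : q = (q.1, glueKE G₁ G₂ (splitKE G₁ G₂ q.2).1 (splitKE G₁ G₂ q.2).2) := by
        rw [glueKE_splitKE]
      rw [hq', mem_QI_sum_iff G₂ hG₂] at hQ
      rw [hq', EBI_sum_eq G₂ hG₂] at hE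
      exact ⟨hQ, hE⟩
    · intro x hx
      rw [Finset.mem_filter] at hx ⊢
      obtain ⟨hQ, hE⟩ := hx
      rw [mem_QI_sum_iff G₂ hG₂]
      refine ⟨hQ, ?_⟩
      rw [EBI_sum_eq G₂ hG₂]
      exact hE
    · intro q _
      show (q.1, glueKE G₁ G₂ (splitKE G₁ G₂ q.2).1 (splitKE G₁ G₂ q.2).2) = q
      rw [glueKE_splitKE]
    · intro x _
      show (x.1, splitKE G₁ G₂ (glueKE G₁ G₂ x.2.1 x.2.2)) = x
      rw [splitKE_glueKE]
  rw [e1, e2]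
  exact key

end Transport

section Instance

variable {X₁ X₂ : Type*} (G₁ : SimpleGraph X₁) (G₂ : SimpleGraph X₂)
  [Fintype X₁] [DecidableEq X₁] [DecidableRel G₁.Adj] [Nonempty X₁] (hG₁ : G₁.Connected)
  [Fintype X₂] [DecidableEq X₂] [DecidableRel G₂.Adj] [Nonempty X₂] (hG₂ : G₂.Connected)

/-- **The glued fibre of two connected cross components.** -/
noncomputable def fibKEESum₂ :
    FibreIter (FibKE (X₁ ⊕ X₂) (G₁ ⊕g G₂)) (AtomKEE (X₁ ⊕ X₂) (G₁ ⊕g G₂)) (LabelKE (X₁ ⊕ X₂)) :=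
  fibKEESum G₂ (FibreIter.ofBit (fibKEEBit G₁ hG₁)) rfl rfl rfl rfl rfl

variable {ι : Type*} [Fintype ι] [DecidableEq ι] [Nonempty ι]

include hG₂ in
/-- **THE ABSTRACT THEOREM OF BOUNDARY (iv) FOR TWO CONNECTED CROSS COMPONENTS AT ONE JUNCTION
WITH THE JOINT ORDER**, on the fibre of the disjoint-union graph. -/
theorem ineq_fibKEESum₂ : Ineq (fibKEESum₂ G₁ G₂ hG₁) (ι := ι) :=
  ineq_fibKEESum G₂ hG₂ (FibreIter.ofBit (fibKEEBit G₁ hG₁)) rfl rfl rfl rfl rfl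
    (ineq_ofBit (fibKEEBit G₁ hG₁))

end Instance

end CrossArm

end Summit.Ventures.PercRepro2
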